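import Literature.AlgebraicGeometry.Frobenioids.PerfectionCoAngular
import Literature.AlgebraicGeometry.Frobenioids.EquivalenceUnitsTransport
import HarnessLib

/-!
# Frobenioids I, Proposition 3.2 (ii) for THE perfection: pull-back morphisms and base-identity
# endomorphisms; and the divisor component of the Prop. 3.2 (i) square (PROOFS)

Mochizuki, *The geometry of Frobenioids I: the general theory*, Kyushu J. Math. **62** (2008)
293–400, Proposition 3.2 (i)(ii) pp. 58–59 [cite: MochizukiFrdI2008, Prop. 3.2 (ii) p.59]: "An arrow of
`C^pf` is a(n) … base-identity endomorphism; … pull-back morphism … if and only if a cofinal collection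
of the system of arrows of `C` that determine this arrow of `C^pf` is so", printed proof (p. 59):
"assertions (i), (ii), (iii) follow immediately from the definitions; Proposition 1.10, (i)".

PROOF-ONLY companion of abc-iut-L1-d9's construction of `C^pf` (`Perfection*.lean`) closing the two typed
slots of `BaseCategoryTheoreticityDefs.lean` (seat abc-iut-L1-t3) that were still open for THE perfection
datum `PreFrobenioidData.perfection hF` (abc-iut DAG nodes `FrdI:Prop3.2(i)`, `FrdI:Prop3.2(ii)`;
sub-DAG cut W8 of plan/L1/DISCHARGE-L1.md):

* `isPullbackMorphism_toPf_map`: the image `(A, 1) → (B, 1)` of a pull-back morphism `φ : A → B` of `C`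
  is a pull-back morphism of `C^pf` (for the operations `Perfection.ops hF` over the base `D`).  Printed
  argument made explicit: every transport `φ_b : A^{(b)} → B^{(b)}` of the degree-one representative of
  `φ` is a Frobenius conjugate of `φ` (`frob_lift_toPfRep`), hence a pull-back morphism of `C`
  (Prop. 1.10 (i) = `IsPullbackMorphism.frobeniusConjugate`, seat abc-iut-L1-t1); a pair
  `(χ : (X₀, n) → (B, 1), β : Base X₀ → Base A)` over `Base φ`, with `χ` represented by
  `ρ : X₀^{(a)} → B^{(b)}`, lifts uniquely through `φ_b` at the level `(a, b)`, and two lifts agree after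
  transport to a common level by the uniqueness half of the pull-back property of `φ_{b'}` there;
* `prop32ii_rest_perfection : Prop32ii_rest (ofFunctor Φ F) (perfection hF)` (base-identity
  endomorphisms: `Base` of the image is `Base φ`, `baseMap_toPf`);
* `prop32i_div_perfection : Prop32i_div (ofFunctor Φ F) (perfection hF) (fun X ↦ Φ(X) → Φ(X)^pf)`: the
  divisor component of the 1-commutative square of Prop. 3.2 (i) along the natural map `Φ → Φ^pf`
  (`Frobenioids.Perfection.of`), from abc-iut-L1-d9's `div_toPf`.
No new definitions; nothing here is specific to the abc programme. Like the rest of the chain this works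
over a bare Frobenioid `hF : IsFrobenioid F` (the standing Frobenius-isotropic hypothesis of §3 is not
needed for (i)(ii), cf. the DISCLOSURE in `Perfection.lean`).
-/

namespace Literature.AlgebraicGeometry.Frobenioids

namespace PreFrobenioid

namespace Perfection

open CategoryTheory Opposite

universe w v v' u u'

variable {D : Type u} [Category.{v} D] {Φ : Dᵒᵖ ⥤ CommMonCat.{w}}
  {C : Type u'} [Category.{v'} C] {F : C ⥤ ElemFrobenioid Φ} {hF : IsFrobenioid F}

/-! ### The transports of the degree-one representative of `φ` -/

/-- The transport `φ_L : A^{(a)} → B^{(b)}` of the degree-one representative of `φ : A → B` to a level `L`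
is the Frobenius conjugate of `φ` along the chosen arrows `A → A^{(a)}`, `B → B^{(b)}`.
[cite: MochizukiFrdI2008, Prop. 1.10 (i) p.34] -/
theorem frob_comp_lift_toPfRep {A B : C} (φ : A ⟶ B) (L : Level (root hF A 1) (root hF B 1))
    (h : (toPfRep hF φ).L.LE L) :
    frob hF A L.a ≫ Level.lift (toPfRep hF φ).L L h (toPfRep hF φ).hom = φ ≫ frob hF B L.b := by
  have e := frob_lift_toPfRep (hF := hF) φ L h
  rwa [frob_frobTrans, frob_frobTrans] at e

/-- The two exponents of a level between degree-one roots `(A, 1)`, `(B, 1)` coincide.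
[cite: MochizukiFrdI2008, Def. 3.1 (iii) p.57] -/
theorem Level.a_eq_b_of_root_one {A B : C} (L : Level (root hF A 1) (root hF B 1)) : L.a = L.b := by
  have e := L.eq
  change 1 * L.a = 1 * L.b at e
  rwa [one_mul, one_mul] at e

/-- Every transport of the degree-one representative of a pull-back morphism `φ` of `C` is a pull-back
morphism of `C` (Prop. 1.10 (i): "if `φ` is a pull-back morphism then so is `φ′`").
[cite: MochizukiFrdI2008, Prop. 1.10 (i) p.34] -/
theorem isPullbackMorphism_lift_toPfRep {A B : C} {φ : A ⟶ B} (hφ : PreFrobenioid.IsPullbackMorphism F φ)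
    (L : Level (root hF A 1) (root hF B 1)) (h : (toPfRep hF φ).L.LE L) :
    PreFrobenioid.IsPullbackMorphism F (Level.lift (toPfRep hF φ).L L h (toPfRep hF φ).hom) :=
  IsPullbackMorphism.frobeniusConjugate hF hφ (frob_comp_lift_toPfRep φ L h) (isFrobeniusType_frob hF A L.a)
    (isFrobeniusType_frob hF B L.b) (by rw [degFr_frob, degFr_frob, Level.a_eq_b_of_root_one L])

/-- The class of any transport of the degree-one representative of `φ` is the image of `φ` in `C^pf`.
[cite: MochizukiFrdI2008, Def. 3.1 (iii) p.57] -/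
theorem mk_lift_toPfRep {A B : C} (φ : A ⟶ B) (L : Level (root hF A 1) (root hF B 1))
    (h : (toPfRep hF φ).L.LE L) :
    Hom.mk ⟨L, Level.lift (toPfRep hF φ).L L h (toPfRep hF φ).hom⟩ = (toPf hF).map φ :=
  Hom.mk_lift (toPfRep hF φ) L h

/-- `Base` of the arrow of a representative whose class has `Base` equal to `β`.
[cite: MochizukiFrdI2008, Prop. 3.2 (i) p.58] -/
theorem base_hom_eq_of_baseMap_eq {X Y : Perfection hF} (r : Rep X Y)
    {β : baseObj F X.obj ⟶ baseObj F Y.obj} (hβ : r.baseMap = β) :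
    Base F r.hom = baseInvFrob hF X.obj r.L.a ≫ β ≫ Base F (frob hF Y.obj r.L.b) := by
  rw [base_hom_eq, hβ]

/-! ### Proposition 3.2 (ii): pull-back morphisms -/

/-- **Prop. 3.2 (ii)**, pull-back morphisms, for THE perfection of a Frobenioid: the image in `C^pf` of a
pull-back morphism of `C` is a pull-back morphism of `C^pf` (with respect to `C^pf → D`).
[cite: MochizukiFrdI2008, Prop. 3.2 (ii) p.59] -/
theorem isPullbackMorphism_toPf_map {A B : C} {φ : A ⟶ B} (hφ : PreFrobenioid.IsPullbackMorphism F φ) :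
    (ops hF).IsPullbackMorphism ((toPf hF).map φ) := by
  intro X χ β hβ
  change (baseObj F X.obj ⟶ baseObj F A) at β
  obtain ⟨⟨⟨a, b, hab⟩, ρ⟩, rfl⟩ := Hom.mk_surjective χ
  change X.idx * a = 1 * b at hab
  change (frobPow hF X.obj a ⟶ frobPow hF B b) at ρ
  change β ≫ Hom.baseMap ((toPf hF).map φ) = Base F (frob hF X.obj a) ≫ Base F ρ ≫ baseInvFrob hF B b at hβ
  rw [baseMap_toPf] at hβ
  -- the transport `φ_b : A^{(b)} → B^{(b)}` of the degree-one representative of `φ`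
  have hLb : (toPfRep hF φ).L.LE (⟨b, b, rfl⟩ : Level (root hF A 1) (root hF B 1)) :=
    ⟨one_dvd _, one_dvd _⟩
  have H1 := frob_comp_lift_toPfRep (hF := hF) φ ⟨b, b, rfl⟩ hLb
  have H2 := isPullbackMorphism_lift_toPfRep hφ _ hLb
  have H3 := mk_lift_toPfRep (hF := hF) φ ⟨b, b, rfl⟩ hLb
  generalize hφb : Level.lift (toPfRep hF φ).L (⟨b, b, rfl⟩ : Level (root hF A 1) (root hF B 1)) hLb
    (toPfRep hF φ).hom = φb at H1 H2 H3
  change frob hF A b ≫ φb = φ ≫ frob hF B b at H1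
  -- the base datum at the level `(a, b)` and the lift through `φ_b`
  have hcompat : Base F ρ = (baseInvFrob hF X.obj a ≫ β ≫ Base F (frob hF A b)) ≫ Base F φb :=
    calc Base F ρ = baseInvFrob hF X.obj a ≫ (Base F (frob hF X.obj a) ≫ Base F ρ ≫ baseInvFrob hF B b) ≫
          Base F (frob hF B b) := base_hom_eq (hF := hF) (X := X) (Y := root hF B 1) ⟨⟨a, b, hab⟩, ρ⟩
      _ = baseInvFrob hF X.obj a ≫ (β ≫ Base F φ) ≫ Base F (frob hF B b) := by rw [hβ]
      _ = baseInvFrob hF X.obj a ≫ β ≫ Base F (frob hF A b ≫ φb) := by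
          rw [H1]; simp only [base_comp, Category.assoc]
      _ = (baseInvFrob hF X.obj a ≫ β ≫ Base F (frob hF A b)) ≫ Base F φb := by
          simp only [base_comp, Category.assoc]
  obtain ⟨ψ₀, hψ₀⟩ :=
    (H2 (frobPow hF X.obj a)).2 ⟨(ρ, baseInvFrob hF X.obj a ≫ β ≫ Base F (frob hF A b)), hcompat⟩
  have hψ₁ : ψ₀ ≫ φb = ρ := congrArg (fun p => p.1.1) hψ₀
  have hψ₂ : Base F ψ₀ = baseInvFrob hF X.obj a ≫ β ≫ Base F (frob hF A b) := congrArg (fun p => p.1.2) hψ₀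
  -- `Base` of the class of `ψ₀` is `β`
  have hbase : Rep.baseMap (X := X) (Y := root hF A 1) ⟨⟨a, b, hab⟩, ψ₀⟩ = β := by
    change Base F (frob hF X.obj a) ≫ Base F ψ₀ ≫ baseInvFrob hF A b = β
    rw [hψ₂]
    simp only [Category.assoc, base_frob_baseInvFrob, base_frob_baseInvFrob_assoc, Category.comp_id]
  refine ⟨Hom.mk ⟨⟨a, b, hab⟩, ψ₀⟩, ⟨?_, hbase⟩, ?_⟩
  · -- `ψ ≫ ((A,1) → (B,1)) = χ`, computed at the triple level `(a, b, b)`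
    rw [← H3, mk_comp_mk, ← mk_compAt (⟨a, b, b, hab, rfl⟩ : Level₃ X (root hF A 1) (root hF B 1))
      ⟨⟨a, b, hab⟩, ψ₀⟩ ⟨⟨b, b, rfl⟩, φb⟩ (Level.le_rfl _) (Level.le_rfl _)]
    unfold compAt
    rw [Level.lift_rfl, Level.lift_rfl]
    change Hom.mk ⟨⟨a, b, _⟩, ψ₀ ≫ φb⟩ = _
    rw [hψ₁]
  · -- uniqueness: two lifts agree after transport to a common level
    rintro ψ' ⟨hc, hb'⟩
    obtain ⟨⟨⟨a', b', hab'⟩, σ⟩, rfl⟩ := Hom.mk_surjective ψ'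
    change X.idx * a' = 1 * b' at hab'
    change (frobPow hF X.obj a' ⟶ frobPow hF A b') at σ
    change Rep.baseMap (X := X) (Y := root hF A 1) ⟨⟨a', b', hab'⟩, σ⟩ = β at hb'
    -- the transport `φ_{b'}` and the composite at the triple level `(a', b', b')`
    have hLb' : (toPfRep hF φ).L.LE (⟨b', b', rfl⟩ : Level (root hF A 1) (root hF B 1)) :=
      ⟨one_dvd _, one_dvd _⟩
    have K3 := mk_lift_toPfRep (hF := hF) φ ⟨b', b', rfl⟩ hLb'
    generalize hφb' : Level.lift (toPfRep hF φ).L (⟨b', b', rfl⟩ : Level (root hF A 1) (root hF B 1)) hLb'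
      (toPfRep hF φ).hom = φb' at K3
    rw [← K3, mk_comp_mk, ← mk_compAt (⟨a', b', b', hab', rfl⟩ : Level₃ X (root hF A 1) (root hF B 1))
      ⟨⟨a', b', hab'⟩, σ⟩ ⟨⟨b', b', rfl⟩, φb'⟩ (Level.le_rfl _) (Level.le_rfl _)] at hc
    unfold compAt at hc
    rw [Level.lift_rfl, Level.lift_rfl] at hc
    change Hom.mk (⟨⟨a', b', _⟩, σ ≫ φb'⟩ : Rep X (root hF B 1)) = Hom.mk ⟨⟨a, b, hab⟩, ρ⟩ at hc
    -- a common level `(Na, Nb)` where the composites agree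
    obtain ⟨N, hN₁, hN₂, e⟩ := Hom.mk_eq_mk.mp hc
    obtain ⟨Na, Nb, hNab⟩ := N
    change X.idx * Na = 1 * Nb at hNab
    have h₁A : Level.LE (⟨a', b', hab'⟩ : Level X (root hF A 1)) ⟨Na, Nb, hNab⟩ := ⟨hN₁.1, hN₁.2⟩
    have h₂A : Level.LE (⟨a, b, hab⟩ : Level X (root hF A 1)) ⟨Na, Nb, hNab⟩ := ⟨hN₂.1, hN₂.2⟩
    have h₁B : Level.LE (⟨b', b', rfl⟩ : Level (root hF A 1) (root hF B 1)) ⟨Nb, Nb, rfl⟩ :=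
      ⟨hN₁.2, hN₁.2⟩
    have h₂B : Level.LE (⟨b, b, rfl⟩ : Level (root hF A 1) (root hF B 1)) ⟨Nb, Nb, rfl⟩ :=
      ⟨hN₂.2, hN₂.2⟩
    have hNB : (toPfRep hF φ).L.LE (⟨Nb, Nb, rfl⟩ : Level (root hF A 1) (root hF B 1)) := hLb.trans h₂B
    -- the transport `φ_N : A^{(Nb)} → B^{(Nb)}`, a pull-back morphism of `C`
    have M2 := isPullbackMorphism_lift_toPfRep hφ _ hNB
    -- both sides of `e` factor through `φ_N`
    have eσ : Level.lift (⟨a', b', hab'⟩ : Level X (root hF B 1)) ⟨Na, Nb, hNab⟩ hN₁ (σ ≫ φb') =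
        Level.lift (⟨a', b', hab'⟩ : Level X (root hF A 1)) ⟨Na, Nb, hNab⟩ h₁A σ ≫
          Level.lift (toPfRep hF φ).L (⟨Nb, Nb, rfl⟩ : Level (root hF A 1) (root hF B 1)) hNB
            (toPfRep hF φ).hom := by
      rw [← Level.lift_trans hLb' h₁B, hφb']
      exact liftLevel_comp hF σ φb' h₁A.1 h₁B.1 h₁B.2 (Level.degFr_eq _ _ h₁A) (Level.degFr_eq _ _ h₁B)
    have eψ : Level.lift (⟨a, b, hab⟩ : Level X (root hF B 1)) ⟨Na, Nb, hNab⟩ hN₂ ρ =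
        Level.lift (⟨a, b, hab⟩ : Level X (root hF A 1)) ⟨Na, Nb, hNab⟩ h₂A ψ₀ ≫
          Level.lift (toPfRep hF φ).L (⟨Nb, Nb, rfl⟩ : Level (root hF A 1) (root hF B 1)) hNB
            (toPfRep hF φ).hom := by
      rw [← Level.lift_trans hLb h₂B, hφb, ← hψ₁]
      exact liftLevel_comp hF ψ₀ φb h₂A.1 h₂B.1 h₂B.2 (Level.degFr_eq _ _ h₂A) (Level.degFr_eq _ _ h₂B)
    have e' := eσ.symm.trans (e.trans eψ)
    generalize Level.lift (toPfRep hF φ).L (⟨Nb, Nb, rfl⟩ : Level (root hF A 1) (root hF B 1)) hNB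
      (toPfRep hF φ).hom = φN at M2 e'
    -- `Base` of the two lifts
    have hBσ : Base F (Level.lift (⟨a', b', hab'⟩ : Level X (root hF A 1)) ⟨Na, Nb, hNab⟩ h₁A σ) =
        baseInvFrob hF X.obj Na ≫ β ≫ Base F (frob hF A Nb) :=
      base_hom_eq_of_baseMap_eq (X := X) (Y := root hF A 1) ⟨⟨Na, Nb, hNab⟩, _⟩
        ((baseMap_lift _ _ h₁A σ).trans hb')
    have hBψ : Base F (Level.lift (⟨a, b, hab⟩ : Level X (root hF A 1)) ⟨Na, Nb, hNab⟩ h₂A ψ₀) =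
        baseInvFrob hF X.obj Na ≫ β ≫ Base F (frob hF A Nb) :=
      base_hom_eq_of_baseMap_eq (X := X) (Y := root hF A 1) ⟨⟨Na, Nb, hNab⟩, _⟩
        ((baseMap_lift _ _ h₂A ψ₀).trans hbase)
    -- uniqueness (injectivity) half of the pull-back property of `φ_N`
    have huN := (M2 (frobPow hF X.obj Na)).1 (Subtype.ext (Prod.ext e' (hBσ.trans hBψ.symm)))
    exact Hom.mk_eq_mk.mpr ⟨⟨Na, Nb, hNab⟩, h₁A, h₂A, huN⟩

/-! ### Proposition 3.2 (ii), the remaining classes, and Proposition 3.2 (i), divisor component -/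

/-- `C → C^pf` preserves base-identity endomorphisms (`Base` of the image of `φ` is `Base φ`).
[cite: MochizukiFrdI2008, Prop. 3.2 (ii) p.59] -/
theorem isBaseIdentity_toPf_map {A : C} {φ : A ⟶ A} (hφ : PreFrobenioid.IsBaseIdentity F φ) :
    (ops hF).IsBaseIdentity ((toPf hF).map φ) := by
  change Hom.baseMap ((toPf hF).map φ) = 𝟙 _
  rw [baseMap_toPf]
  exact hφ

/-- `C → C^pf` preserves pull-back morphisms, in the interface form `PreservesMor`.
[cite: MochizukiFrdI2008, Prop. 3.2 (ii) p.59] -/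
theorem preservesMor_isPullbackMorphism (hF : IsFrobenioid F) :
    PreFrobenioidData.PreservesMor (toPf hF) (PreFrobenioidData.ofFunctor Φ F).IsPullbackMorphism
      (ops hF).IsPullbackMorphism :=
  fun _ _ φ h => isPullbackMorphism_toPf_map ((PreFrobenioidData.ofFunctor_isPullbackMorphism F φ).mp h)

/-- **Prop. 3.2 (ii)**, the remaining printed classes, for THE perfection of a Frobenioid: `C → C^pf`
preserves base-identity endomorphisms and pull-back morphisms — the named statement `Prop32ii_rest` of
`BaseCategoryTheoreticityDefs.lean` DISCHARGED for the datum `PreFrobenioidData.perfection hF` (with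
`prop32ii_perfection` this closes every typed clause of Prop. 3.2 (ii) for that datum).
[cite: MochizukiFrdI2008, Prop. 3.2 (ii) p.59] -/
theorem prop32ii_rest_perfection (hF : IsFrobenioid F) :
    Literature.AlgebraicGeometry.Frobenioids.Prop32ii_rest (PreFrobenioidData.ofFunctor Φ F)
      (PreFrobenioidData.perfection hF) :=
  ⟨fun _ _ h => isBaseIdentity_toPf_map h, preservesMor_isPullbackMorphism hF⟩

/-- **Prop. 3.2 (i)**, divisor component of the 1-commutative square, for THE perfection of a Frobenioid,
along the natural map `Φ(X) → Φ(X)^pf` (`Frobenioids.Perfection.of`) and the on-the-nose commutation of the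
base functors (`toPfCompBaseIso`): `Div((A,1) → (B,1)) = Div(φ)^{1/1}` — the named statement `Prop32i_div`
of `BaseCategoryTheoreticityDefs.lean` DISCHARGED for the datum `PreFrobenioidData.perfection hF`.
[cite: MochizukiFrdI2008, Prop. 3.2 (i) p.58] -/
theorem prop32i_div_perfection (hF : IsFrobenioid F) :
    Literature.AlgebraicGeometry.Frobenioids.Prop32i_div (PreFrobenioidData.ofFunctor Φ F)
      (PreFrobenioidData.perfection hF) (fun X => Frobenioids.Perfection.of (Φ.obj (op X))) := by
  refine ⟨toPfCompBaseIso, fun A B φ => ?_⟩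
  change Hom.div ((toPf hF).map φ) =
    Frobenioids.Perfection.map (pull Φ (𝟙 (baseObj F A))) (Frobenioids.Perfection.of _ (Div F φ))
  rw [div_toPf, show pull Φ (𝟙 (baseObj F A)) = MonoidHom.id _ from MonoidHom.ext fun y => pull_id Φ _ y,
    Frobenioids.Perfection.map_id]
  rfl

end Perfection

end PreFrobenioid

end Literature.AlgebraicGeometry.Frobenioids
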